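import Summits.CriticalPhenomena.PercolationContinuityZ3.Theorems.PercNearOneGluingNoHeavyLowerTailQuantitativeBHKRepulsionGlauber
import Literature.Probability.LatticeModels.ProdBernoulliIndependence
import Literature.Probability.Percolation.KozmaNitzanPreFKG
import HarnessLib

/-!
# Strictness of the two-cluster repulsion for connection events (exactness criterion, positive half)

Support file (`--supports stmt-CriticalPhenomena-4575`), prover seat `prim-rate-mine-2` (lane prim-rate, constants-miner (c), BENCH row
M2-R15; `run/shared/lean/prim/prim-rate/prim-rate-mine-2/CANDIDATES.md` §gen-3, PROOFS.md §P13).  No definitions, no named facts, no sorries;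
standard axioms.

van den Berg–Kahn (2001, Thm 1.1) and van den Berg–Häggström–Kahn (2006, eq. (2) / Thm 1.4) prove the WEAK inequality
`P(s↔a | s↮t)·P(t↔o | s↮t) ≥ P(s↔a, t↔o | s↮t)`.  The lane's census found the kernel Glauber floor of this repulsion (`QuantBHK.twoCluster_repulsion_ge_glauberTerm`,
p316358) COMPLETE on all data, and the exactness criterion behind it (PROOFS §P13): for weights non-degenerate on their support graph `Γ`
(`0 < w < 1` on `Γ`, `0` off `Γ`), `s ≠ t`, `a, o ∉ {s,t}`, the inequality is STRICT if and only if `a` and `o` lie in a common connected component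
`K` of `Γ − {s,t}` that has a `Γ`-neighbour of `s` and a `Γ`-neighbour of `t`; otherwise `{s↔a}` and `{t↔o}` are conditionally independent.
THIS FILE proves the strictness half: under that graph condition (witnessed by `u, k ∈ K` with `su, tk ∈ Γ` and `Γ−{s,t}`-paths `u ⇝ a`,
`u ⇝ o`, `k ⇝ o`),

  `μ(D)·μ(D ∩ {s↔a} ∩ {t↔o}) < μ(D ∩ {s↔a})·μ(D ∩ {t↔o})`,   `D = {s ↮ t}`

(`QuantBHK.twoCluster_repulsion_openConn_pos`).  Proof: the Glauber floor at the pair `e = su` is positive — at the configuration `ζ` = (edges of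
the two paths from `u`) opening `e` is admissible, makes `a` join `C_s`, and kills the residual `t–o` connection (which had probability ≥ the
weight of the path `t k ⇝ o`), and `ζ` has positive weight.
[cite: VandenbergHaggstromKahn2005, Thm. 1.4 and eq. (2) (pp. 2, 7)] [cite: VandenbergKahn2001, Thm. 1.1 (p. 1)]
-/

noncomputable section

namespace Summit.CriticalPhenomena.PercolationContinuityZ3.Theorems

open MeasureTheory Set Literature.Probability.LatticeModels Literature.Probability.Percolation
open scoped Classical
open Literature.Probability.Percolation.BHK2006 DecisionTree

namespace QuantBHK

universe v

variable {V : Type v} [Fintype V]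

omit [Fintype V] in
/-- A vertex met by no pair of the configuration is isolated: everything reachable from it is itself. [folklore] -/
theorem eq_of_reachable_of_forall_notMem {S : Set (Sym2 V)} {x y : V} (hx : ∀ f ∈ S, x ∉ f)
    (h : (openGraph S).Reachable x y) : y = x := by
  obtain ⟨p⟩ := h
  cases p with
  | nil => rfl
  | cons hadj _ =>
    rw [openGraph, SimpleGraph.fromEdgeSet_adj] at hadj
    exact absurd (Sym2.mem_mk_left _ _) (hx _ hadj.1)

omit [Fintype V] in
/-- Edges of a walk in `openGraph S` lie in `S` and are not loops. [folklore] -/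
theorem mem_and_not_isDiag_of_mem_edges {S : Set (Sym2 V)} {x y : V} (p : (openGraph S).Walk x y) {f : Sym2 V}
    (hf : f ∈ p.edges) : f ∈ S ∧ ¬ f.IsDiag := by
  have h := p.edges_subset_edgeSet hf
  rw [openGraph, SimpleGraph.edgeSet_fromEdgeSet] at h
  exact h

omit [Fintype V] in
/-- A walk of `openGraph S` transfers to `openGraph S'` for any `S'` containing its edges. [folklore] -/
theorem reachable_of_walk_edges_subset {S S' : Set (Sym2 V)} {x y : V} (p : (openGraph S).Walk x y)
    (h : ∀ f ∈ p.edges, f ∈ S') : (openGraph S').Reachable x y := by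
  refine ⟨p.transfer (openGraph S') fun f hf => ?_⟩
  rw [openGraph, SimpleGraph.edgeSet_fromEdgeSet]
  exact ⟨h f hf, (mem_and_not_isDiag_of_mem_edges p hf).2⟩

/-- **Strictness of the two-cluster repulsion for connection events.**  Weights `w` non-degenerate on their support `E` (`w = 0` off `E`,
`0 < w < 1` on `E`), `s ≠ t`, `a, o ∉ {s, t}`, and the graph condition of the exactness criterion: pairs `su, tk ∈ E` and paths `u ⇝ a`,
`u ⇝ o`, `k ⇝ o` in the support graph with the vertices `s, t` deleted (so `a, o, u, k` lie in one component `K` of `Γ − {s,t}`, adjacent to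
`s` and to `t`).  Then, with `D = {s ↮ t}`:  `μ(D)·μ(D ∩ {s↔a} ∩ {t↔o}) < μ(D ∩ {s↔a})·μ(D ∩ {t↔o})`, i.e.
`P(s↔a, t↔o | s↮t) < P(s↔a | s↮t)·P(t↔o | s↮t)` — van den Berg–Kahn's / BHK's inequality (2) is STRICT.  (Under the negation of the graph
condition the two events are conditionally independent; BENCH row M2-R15, PROOFS §P13.)  Proof: `twoCluster_repulsion_ge_glauberTerm` at
`e = su` with an explicit positive-weight configuration.
[cite: VandenbergHaggstromKahn2005, Thm. 1.4 and eq. (2) (pp. 2, 7)] -/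
theorem twoCluster_repulsion_openConn_pos (w : Sym2 V → unitInterval) (E : Set (Sym2 V))
    (hE0 : ∀ f, f ∉ E → (w f : ℝ) = 0) (hE1 : ∀ f ∈ E, 0 < (w f : ℝ) ∧ (w f : ℝ) < 1)
    (s t a o u k : V) (hst : s ≠ t) (ha : a ≠ s ∧ a ≠ t) (ho : o ≠ s ∧ o ≠ t)
    (hsu : s(s, u) ∈ E) (htk : s(t, k) ∈ E)
    (hua : (openGraph {f | f ∈ E ∧ s ∉ f ∧ t ∉ f}).Reachable u a)
    (huo : (openGraph {f | f ∈ E ∧ s ∉ f ∧ t ∉ f}).Reachable u o)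
    (hko : (openGraph {f | f ∈ E ∧ s ∉ f ∧ t ∉ f}).Reachable k o) :
    (prodBernoulli w).real {ω : BondConfig V | ¬ (openGraph ω).Reachable s t} *
        (prodBernoulli w).real ({ω : BondConfig V | ¬ (openGraph ω).Reachable s t} ∩ openConn s a ∩ openConn t o) <
      (prodBernoulli w).real ({ω : BondConfig V | ¬ (openGraph ω).Reachable s t} ∩ openConn s a) *
        (prodBernoulli w).real ({ω : BondConfig V | ¬ (openGraph ω).Reachable s t} ∩ openConn t o) := by
  set μ := prodBernoulli w with hμ
  set w' : Sym2 V → ℝ := fun f => (w f : ℝ) with hw'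
  have hw0 : ∀ f, 0 ≤ w' f := fun f => (w f).2.1
  have hw1 : ∀ f, w' f ≤ 1 := fun f => (w f).2.2
  have hw1' : ∀ f, 0 < 1 - w' f := by
    intro f
    by_cases hf : f ∈ E
    · have := (hE1 f hf).2; simp only [hw']; linarith
    · have := hE0 f hf; simp only [hw']; linarith
  set D : Set (BondConfig V) := {ω : BondConfig V | ¬ (openGraph ω).Reachable s t} with hD
  have hmeas : ∀ S : Set (BondConfig V), MeasurableSet S := fun _ => MeasurableSet.of_discrete
  set Γ' : Set (Sym2 V) := {f | f ∈ E ∧ s ∉ f ∧ t ∉ f} with hΓ'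
  have hΓ's : ∀ f ∈ Γ', s ∉ f := fun f hf => hf.2.1
  have hΓ't : ∀ f ∈ Γ', t ∉ f := fun f hf => hf.2.2
  -- the witnessing paths and the configuration `ζ`
  obtain ⟨p1⟩ := hua
  obtain ⟨p2⟩ := huo
  obtain ⟨p3⟩ := hko
  have hus : u ≠ s := fun h => ha.1 (eq_of_reachable_of_forall_notMem hΓ's (h ▸ (⟨p1⟩ : (openGraph Γ').Reachable u a)))
  have hut : u ≠ t := fun h => ha.2 (eq_of_reachable_of_forall_notMem hΓ't (h ▸ (⟨p1⟩ : (openGraph Γ').Reachable u a)))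
  have hks : k ≠ s := fun h => ho.1 (eq_of_reachable_of_forall_notMem hΓ's (h ▸ (⟨p3⟩ : (openGraph Γ').Reachable k o)))
  set ζ : Set (Sym2 V) := {f | f ∈ p1.edges ∨ f ∈ p2.edges} with hζ
  have hζΓ : ∀ f ∈ ζ, f ∈ Γ' := by
    intro f hf
    rcases hf with hf | hf
    · exact (mem_and_not_isDiag_of_mem_edges p1 hf).1
    · exact (mem_and_not_isDiag_of_mem_edges p2 hf).1
  set e : Sym2 V := s(s, u) with he
  have heζ : e ∉ ζ := fun h => (hζΓ e h).2.1 (Sym2.mem_mk_left s u)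
  have hζe : ζ \ {e} = ζ := Set.sdiff_singleton_eq_self heζ
  have heE : e ∈ E := hsu
  -- (i) opening `e` at `ζ` keeps `s ↮ t`
  have hins_t : ∀ f ∈ insert e ζ, t ∉ f := by
    intro f hf
    rcases Set.mem_insert_iff.1 hf with hf | hf
    · rw [hf, he, Sym2.mem_iff]
      rintro (h | h)
      · exact hst h.symm
      · exact hut h.symm
    · exact hΓ't f (hζΓ f hf)
  have hζD : insert e ζ ∈ D := fun h => hst (eq_of_reachable_of_forall_notMem hins_t h.symm)
  -- (ii) after opening `e`, both `a` and `o` join `C_s`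
  have hadj : (openGraph (insert e ζ)).Adj s u := by
    rw [openGraph, SimpleGraph.fromEdgeSet_adj]
    exact ⟨Set.mem_insert _ _, hus.symm⟩
  have hsa : a ∈ openCluster (insert e ζ) s :=
    hadj.reachable.trans (reachable_of_walk_edges_subset p1 fun f hf => Set.mem_insert_of_mem _ (Or.inl hf))
  have hso : o ∈ openCluster (insert e ζ) s :=
    hadj.reachable.trans (reachable_of_walk_edges_subset p2 fun f hf => Set.mem_insert_of_mem _ (Or.inr hf))
  -- (iii) before, `C_s = {s}`
  have hζs : ∀ f ∈ ζ \ {e}, s ∉ f := fun f hf => hΓ's f (hζΓ f (by rw [hζe] at hf; exact hf))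
  have hCs : ∀ y ∈ openCluster (ζ \ {e}) s, y = s := fun y hy => eq_of_reachable_of_forall_notMem hζs hy
  have hna : a ∉ openCluster (ζ \ {e}) s := fun h => ha.1 (hCs a h)
  -- the residual `t–o` connection probability
  set Rf : Set V → ℝ := fun W => μ.real {η : BondConfig V | (openGraph (η \ {f | ∃ x ∈ W, x ∈ f})).Reachable t o} with hRf
  have hRanti : Antitone Rf := residual_antitone w t o
  -- (iv) before opening: the residual probability is at least the weight of the path `t k ⇝ o`
  set η0 : Finset (Sym2 V) := insert s(t, k) p3.edges.toFinset with hη0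
  have hη0E : ∀ f ∈ η0, f ∈ E := by
    intro f hf
    rcases Finset.mem_insert.1 hf with hf | hf
    · rw [hf]; exact htk
    · exact (mem_and_not_isDiag_of_mem_edges p3 (List.mem_toFinset.1 hf)).1.1
  have hη0s : ∀ f ∈ η0, s ∉ f := by
    intro f hf
    rcases Finset.mem_insert.1 hf with hf | hf
    · rw [hf, Sym2.mem_iff]
      rintro (h | h)
      · exact hst h
      · exact hks h.symm
    · exact (mem_and_not_isDiag_of_mem_edges p3 (List.mem_toFinset.1 hf)).1.2.1
  have hRpos : 0 < Rf (openCluster (ζ \ {e}) s) := by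
    have h1 : μ.real {η : BondConfig V | (↑η0 : Set (Sym2 V)) ⊆ η} ≤ Rf (openCluster (ζ \ {e}) s) := by
      refine measureReal_mono fun η hη => ?_
      have hsub : ∀ f ∈ η0, f ∈ η \ {f | ∃ x ∈ openCluster (ζ \ {e}) s, x ∈ f} := by
        intro f hf
        refine ⟨hη (Finset.mem_coe.2 hf), ?_⟩
        rintro ⟨x, hx, hxf⟩
        rw [hCs x hx] at hxf
        exact hη0s f hf hxf
      have hkt : k ≠ t := fun h => ho.2 (eq_of_reachable_of_forall_notMem hΓ't (h ▸ (⟨p3⟩ : (openGraph Γ').Reachable k o)))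
      have hadj' : (openGraph (η \ {f | ∃ x ∈ openCluster (ζ \ {e}) s, x ∈ f})).Adj t k := by
        rw [openGraph, SimpleGraph.fromEdgeSet_adj]
        exact ⟨hsub _ (Finset.mem_insert_self _ _), hkt.symm⟩
      exact hadj'.reachable.trans (reachable_of_walk_edges_subset p3 fun f hf =>
        hsub f (Finset.mem_insert_of_mem (List.mem_toFinset.2 hf)))
    have h2 : μ.real {η : BondConfig V | (↑η0 : Set (Sym2 V)) ⊆ η} = ∏ f ∈ η0, (w f : ℝ) := prodBernoulli_real_subset w η0
    have h3 : 0 < ∏ f ∈ η0, (w f : ℝ) := Finset.prod_pos fun f hf => (hE1 f (hη0E f hf)).1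
    linarith
  -- (v) after opening: `o ∈ C_s`, so the residual probability vanishes
  have hRzero : Rf (openCluster (insert e ζ) s) = 0 := by
    have h1 : {η : BondConfig V | (openGraph (η \ {f | ∃ x ∈ openCluster (insert e ζ) s, x ∈ f})).Reachable t o} = ∅ := by
      ext η
      simp only [Set.mem_setOf_eq, Set.mem_empty_iff_false, iff_false]
      intro h
      have ho' : ∀ f ∈ η \ {f | ∃ x ∈ openCluster (insert e ζ) s, x ∈ f}, o ∉ f :=
        fun f hf hof => hf.2 ⟨o, hso, hof⟩
      exact ho.2 (eq_of_reachable_of_forall_notMem ho' h.symm).symm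
    simp only [hRf, h1, measureReal_empty]
  -- the Glauber integrand, its sign, and its value at `ζ`
  set F : Set V → ℝ := fun W => if a ∈ W then 1 else 0 with hF
  have hFmono : Monotone F := by
    intro W W' h
    simp only [hF]
    by_cases hb : a ∈ W
    · rw [if_pos hb, if_pos (h hb)]
    · rw [if_neg hb]; split_ifs <;> norm_num
  set I : BondConfig V → ℝ := fun ω => D.indicator (fun _ => (1 : ℝ)) (insert e ω) *
    ((F (openCluster (insert e ω) s) - F (openCluster (ω \ {e}) s)) *
      (Rf (openCluster (ω \ {e}) s) - Rf (openCluster (insert e ω) s))) with hI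
  have hmono_cl : ∀ ω : BondConfig V, openCluster (ω \ {e}) s ⊆ openCluster (insert e ω) s :=
    fun ω => openCluster_mono (Set.sdiff_subset.trans (Set.subset_insert e ω)) s
  have hI0 : ∀ ω, 0 ≤ I ω := by
    intro ω
    refine mul_nonneg (Set.indicator_nonneg (fun _ _ => zero_le_one) _) (mul_nonneg ?_ ?_)
    · exact sub_nonneg.2 (hFmono (hmono_cl ω))
    · exact sub_nonneg.2 (hRanti (hmono_cl ω))
  have hIζ : I ζ = Rf (openCluster (ζ \ {e}) s) := by
    simp only [hI]
    rw [Set.indicator_of_mem hζD, hRzero]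
    simp only [hF, if_pos hsa, if_neg hna]
    ring
  -- `ζ` has positive weight, hence the Glauber floor is positive
  have hwζ : 0 < weight w' ζ := by
    refine Finset.prod_pos fun f _ => ?_
    split_ifs with hf
    · exact (hE1 f (hζΓ f hf).1).1
    · exact hw1' f
  have hint_pos : 0 < ∫ ω, I ω ∂μ := by
    rw [integral_prodBernoulli_eq_sum]
    have h1 : weight w' ζ * I ζ ≤ ∑ ω, weight w' ω * I ω :=
      Finset.single_le_sum (fun ω _ => mul_nonneg (weight_nonneg hw0 hw1 ω) (hI0 ω)) (Finset.mem_univ ζ)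
    have h2 : 0 < weight w' ζ * I ζ := by rw [hIζ]; exact mul_pos hwζ hRpos
    linarith
  have hD0 : 0 < μ.real D := by
    have h1 : μ.real {ω : BondConfig V | ∀ i ∈ (Finset.univ : Finset (Sym2 V)), i ∉ ω} ≤ μ.real D := by
      refine measureReal_mono fun ω hω h => hst ?_
      exact (eq_of_reachable_of_forall_notMem (fun f hf _ => hω f (Finset.mem_univ f) hf) h).symm
    rw [prodBernoulli_real_forall_notMem] at h1
    have h2 : 0 < ∏ i ∈ (Finset.univ : Finset (Sym2 V)), (1 - (w i : ℝ)) := Finset.prod_pos fun f _ => hw1' f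
    linarith
  have hwe : 0 < (w e : ℝ) * (1 - w e) := mul_pos (hE1 e heE).1 (hw1' e)
  -- the kernel floor, with its integrals identified
  have key := twoCluster_repulsion_ge_glauberTerm w s t o e F hFmono
  rw [← hμ, ← hD] at key
  have hFind : (fun ω : BondConfig V => F (openCluster ω s)) = (openConn s a).indicator fun _ => (1 : ℝ) := by
    funext ω; simp only [hF, Set.indicator_apply]; rfl
  have h1 : ∫ ω in D, F (openCluster ω s) ∂μ = μ.real (D ∩ openConn s a) := by
    rw [hFind, integral_indicator (hmeas _), Measure.restrict_restrict (hmeas _), integral_const, smul_eq_mul, mul_one,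
      measureReal_restrict_apply_univ, Set.inter_comm]
  have h2 : ∫ ω in D ∩ openConn t o, F (openCluster ω s) ∂μ = μ.real (D ∩ openConn s a ∩ openConn t o) := by
    rw [hFind, integral_indicator (hmeas _), Measure.restrict_restrict (hmeas _), integral_const, smul_eq_mul, mul_one,
      measureReal_restrict_apply_univ]
    congr 1
    ext ω; simp only [Set.mem_inter_iff]; tauto
  rw [h1, h2] at key
  have hlhs : 0 < μ.real D * ((w e : ℝ) * (1 - w e) * ∫ ω, I ω ∂μ) := mul_pos hD0 (mul_pos hwe hint_pos)
  have key' : μ.real D * ((w e : ℝ) * (1 - w e) * ∫ ω, I ω ∂μ) ≤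
      μ.real (D ∩ openConn s a) * μ.real (D ∩ openConn t o) - μ.real D * μ.real (D ∩ openConn s a ∩ openConn t o) := key
  linarith

end QuantBHK

end Summit.CriticalPhenomena.PercolationContinuityZ3.Theorems
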